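import Summits.FinalStateConjecture.FinalStateConjecture.Theses.MergerLatticeBudget
import HarnessLib.Audit

/-!
# Strategist r1 sketch for crux `MergerLatticeBudget.QuietLeaves` (stmt-FinalStateConjecture-10910)

Companion of `STRATEGY-CENSUS.md` (r1 revision). Kernel-checked bookkeeping only, no new mathematics:

* `QuietLeavesTame` — the pre-registered repair C′ of the route's KILL CRITERIA (hypothesis
  "sole strongly-asymptotically-flat end, smooth at infinity to ALL orders with DR rates (1,2)"
  inserted after `∀ D ∈ admissibleVacuumData X,`; the block is otherwise BYTE-IDENTICAL to the crux).
* `quietLeavesTame_of_quietLeaves : QuietLeaves → QuietLeavesTame` — C′ is a WEAKENING of the crux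
  (so the rough-tail witness, which is not in the C′ class, does not transfer), i.e. the redirect goes
  the right way: any line for C′ is NOT a line for the crux as typed, and the crux as typed has none
  (it is refuted on paper; conditional negation
  `Cruxes.QuietLeaves.Strategist.not_quietLeaves_of_loudCompleteDevelopmentExists`).
* the conditional negation itself is s2's `Cruxes/QuietLeaves/StrategistNegation.lean`
  (`Strategist.not_quietLeaves_of_loudCompleteDevelopmentExists`, rc 0 there; not imported here because
  crux workfiles are not part of the farm build).

Nothing here is a line or a split of the crux (both are impossible for a false statement: a proved
composition `stub₁ → … → QuietLeaves` or `Sub₁ → … → QuietLeaves` with true antecedents would prove it).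
-/

namespace Summit.FinalStateConjecture.FinalStateConjecture.Cruxes.QuietLeaves.StrategistR1

open Summit.FinalStateConjecture.FinalStateConjecture
open scoped BigOperators Topology Manifold ContDiff ENNReal
open Filter Set Function TopologicalSpace

/-- C′ (route KILL CRITERIA, refuter g2 `Repair2.lean`): `QuietLeaves` restricted to data with a sole
strongly asymptotically flat end that is smooth at infinity to all orders (DR rates `β = 1, γ = 2`,
`nh = nk = m` for every `m`). This is the statement the route should carry after `route edit --restate`
(or as a new item `QuietLeavesR`), with the same conjunct threaded through `GenericLegs`' property. -/
def QuietLeavesTame : Prop :=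
  open Literature.Geometry.Lorentzian in ∀ (X : Type) [TopologicalSpace X] [ChartedSpace E3 X] [IsManifold (𝓡 3) ((⊤ : ℕ∞) : WithTop ℕ∞) X] [T2Space X] [SecondCountableTopology X] [ConnectedSpace X], ∀ D ∈ admissibleVacuumData X, (∃ (e : AFEnd X) (Madm : ℝ), e.IsSoleEnd ∧ ∀ m : ℕ, e.IsStronglyAsymptoticallyFlatWith D Madm 1 2 m m) → ∀ 𝒟 : VacuumCauchyDevelopment D, 𝒟.IsMaximal → Summit.FinalStateConjecture.HasCompleteNullInfinity 𝒟.toCauchyDevelopment → (∃ (N₀ : ℕ) (m₀ : ℝ), 0 < m₀ ∧ ∀ (k : ℕ) (ε : ENNReal), 0 < ε → ∀ K : Set 𝒟.carrier, IsCompact K → ∃ (N : ℕ) (M a : Fin N → ℝ) (S : Set 𝒟.carrier), N ≤ N₀ ∧ (∀ i, m₀ ≤ M i ∧ M i ≤ m₀⁻¹) ∧ Disjoint S (𝒟.metric.causalPast 𝒟.timeOrientation K) ∧ (∃ (R ρ : Fin N → ℝ) (mo : Fin N → lorentzGroup × E4) (r : Fin N → E4 → ℝ) (B : Fin N → ModelBackground)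 (U₀ : TopologicalSpace.Opens E4) (B₀ : ModelBackground) (Ψ : ∀ i, (B i).domain → 𝒟.carrier) (Ψ₀ : B₀.domain → 𝒟.carrier) (L W : ∀ i, Set (B i).domain) (L₀ W₀ : Set B₀.domain), (∀ i, r i = fun x => Kerr.radius (a i) (poincareInv (mo i).1 (mo i).2 x)) ∧ (∀ i, B i = (⟨⟨poincareInv (mo i).1 (mo i).2 ⁻¹' (Kerr.region (a i) (M i) : Set E4), (Kerr.region (a i) (M i)).isOpen.preimage (continuous_poincareInv (mo i).1 (mo i).2)⟩, boostedKerrBilin (mo i).1 (mo i).2 (M i) (a i), fun x => poincareInv (mo i).1 (mo i).2 x 0, r i⟩ : ModelBackground)) ∧ B₀ = (⟨U₀, fun _ => Minkowski.bilin, fun x => x 0 - Real.sqrt (1 + E4.spatialNorm x ^ 2), E4.spatialNorm⟩ : ModelBackground) ∧ (∀ i, L i = {x | -1 < (B i).time x.1 ∧ (B i).time x.1 < 1 ∧ (B i).radius x.1 < R i + 1} ∧ W i = {x | 0 < (B i).time x.1 ∧ (B i).time x.1 < 1 ∧ (B i).radius x.1 ≤ R i}) ∧ L₀ = {x | -1 <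 B₀.time x.1 ∧ B₀.time x.1 < 1} ∧ W₀ = {x | 0 < B₀.time x.1 ∧ B₀.time x.1 < 1} ∧ (∀ i, 0 < M i ∧ |a i| ≤ M i ∧ 0 < ρ i ∧ ρ i < R i ∧ 2 * M i ≤ R i) ∧ {x : E4 | -1 < x 0 - Real.sqrt (1 + E4.spatialNorm x ^ 2) ∧ ∀ i, ρ i < r i x} ⊆ (U₀ : Set E4) ∧ (∀ i, ContMDiffOn 𝓘(ℝ, E4) (𝓡 4) ((⊤ : ℕ∞) : WithTop ℕ∞) (Ψ i) (L i) ∧ Topology.IsOpenEmbedding ((L i).restrict (Ψ i)) ∧ Ψ i '' L i ⊆ 𝒟.metric.causalFuture 𝒟.timeOrientation (Set.range 𝒟.embed)) ∧ ContMDiffOn 𝓘(ℝ, E4) (𝓡 4) ((⊤ : ℕ∞) : WithTop ℕ∞) Ψ₀ L₀ ∧ Topology.IsOpenEmbedding (L₀.restrict Ψ₀) ∧ Ψ₀ '' L₀ ⊆ 𝒟.metric.causalFuture 𝒟.timeOrientation (Set.range 𝒟.embed) ∧ (∀ i, 𝒟.toSpacetime.truncDeviationCk (B i) (Ψ i) k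 (R i) 0 ≤ ε) ∧ 𝒟.toSpacetime.deviationCk B₀ Ψ₀ k 0 ≤ ε ∧ Pairwise (Function.onFun Disjoint fun i => Ψ i '' {x | x ∈ L i ∧ (B i).radius x.1 ≤ R i}) ∧ (∀ i, Ψ i '' {x | (B i).time x.1 = 0 ∧ ρ i < (B i).radius x.1 ∧ (B i).radius x.1 ≤ R i} ⊆ Ψ₀ '' L₀) ∧ (∀ i, Ψ₀ '' {x | B₀.time x.1 = 0 ∧ ρ i < r i x.1 ∧ r i x.1 < R i} ⊆ Ψ i '' L i) ∧ S = Ψ₀ '' B₀.timeSlab 0 ∪ ⋃ i, Ψ i '' (B i).truncTimeSlab (R i) 0 ∧ Ψ₀ '' W₀ ∪ ⋃ i, Ψ i '' W i ⊆ 𝒟.metric.chronologicalFuture 𝒟.timeOrientation S ∧ Summit.FinalStateConjecture.exteriorOf 𝒟.toCauchyDevelopment (Ψ₀ '' W₀ ∪ ⋃ i, Ψ i '' W i) \ (Ψ₀ '' W₀ ∪ ⋃ i, Ψ i '' W i) ⊆ 𝒟.metric.causalPast 𝒟.timeOrientation S))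

/-- The repair is a weakening: the crux as typed implies C′ (drop the extra hypothesis). [folklore] -/
theorem quietLeavesTame_of_quietLeaves (h : Theses.MergerLatticeBudget.QuietLeaves) : QuietLeavesTame := by
  intro X _ _ _ _ _ _ D hD _ 𝒟 h𝒟 hI
  exact h X D hD 𝒟 h𝒟 hI

end Summit.FinalStateConjecture.FinalStateConjecture.Cruxes.QuietLeaves.StrategistR1
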